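import Summits.CriticalPhenomena.PercolationContinuityZ3.Theorems.PercNearOneGluingNoHeavyLowerTailStarSetResidualPoolInst
import Summits.CriticalPhenomena.PercolationContinuityZ3.Theorems.PercNearOneGluingNoHeavyLowerTailStarSetResidualPoolWordsA
import Summits.CriticalPhenomena.PercolationContinuityZ3.Theorems.PercNearOneGluingNoHeavyLowerTailStarSetResidualPoolWordsB
import Summits.CriticalPhenomena.PercolationContinuityZ3.Theorems.PercNearOneGluingNoHeavyLowerTailStarSetResidualPoolWordsC
import HarnessLib

/-!
# `NoHeavyLowerTail` (stmt-CriticalPhenomena-4575) — the residual bound, II: core units (U1-PROOF.md §7; blueprint §G4)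

Support file (prover `prim-gen-swap` gen 15; `--supports stmt-CriticalPhenomena-4575`).  No definitions, no named facts, no sorries.

The CORE residual units `u = (S, X)` — those all of whose riders pass through `r` — come in three kinds, read off from the data of
`StarSet.residual_unit_data` (`Jf u` the first open forest class, `ef u ∈ Jf u` / `ēf u` the ports of the hub): group units `UG`
(type R2, `dom X ē ∋ r`, not balanced, not a bundle), cold `I₀`-units `UC` (type R1 with `dom X e ≠ I₀`) and bundle units `UH`
(`dom X q₀ = I₀` for the port `q₀ = P I₀` of the hub).  This file checks the hypotheses of `StarSet.residual_pool_inst` for them and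
bounds the resulting pool words by class-word capacities (`pool_words_self_le`, `pool_words_cross_le`, `pool_words_selfI_le`,
`pool_words_crossI_le`): the core units are paid by the pool credit `Π_{K ∉ Pool}(1 − θ_K)` plus the capacities `C_T` of the SELF / SELF′ /
SELF_I / CROSS_I class-sets and the `cr`-parts of the CROSS class-sets.

* `StarSet.residual_core_bound`.
-/

namespace Summit.CriticalPhenomena.PercolationContinuityZ3.Theorems

open Finset
open scoped BigOperators Classical

namespace StarSet

variable {ι V : Type*} [Fintype ι] [LinearOrder ι] [DecidableEq V]

/-- **The core residual units are paid by the pool credit and the SELF / SELF′ / CROSS / SELF_I / CROSS_I words.**  See the file header. -/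
theorem residual_core_bound (P P' : ι → V) (hPP' : ∀ X, P X ≠ P' X)
    (hinj : Function.Injective fun X => (s(P X, P' X) : Sym2 V)) (r : V) (F : Finset ι)
    (θ : ι → ℝ) (hθ0 : ∀ X, 0 ≤ θ X) (hθ1 : ∀ X, θ X < 1)
    (O : ι → V → ℝ) (hO0 : ∀ X d, 0 ≤ O X d)
    (hO1 : ∀ X d, (P X = d ∨ P' X = d) → θ X ≤ (1 - θ X) * O X d)
    (dom : ι → V → ι)
    (hdom : ∀ X ∉ F, ∀ d, (P X = d ∨ P' X = d) →
      dom X d ∈ F ∧ (P (dom X d) = d ∨ P' (dom X d) = d) ∧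
        (∀ u, (P (dom X d) = u ∨ P' (dom X d) = u) → (P X = u ∨ P' X = u) → u = d) ∧ θ X ≤ θ (dom X d))
    (I₀ : ι) (hI₀pool : ¬ ((I₀ ∉ F ∧ (P I₀ = r ∨ P' I₀ = r)) ∨ (I₀ ∈ F ∧ P I₀ = r)))
    (hleaf : ∀ I ∈ F, P' I = r → I = I₀) (hI₀r : I₀ ∈ F → P' I₀ = r)
    (U : Finset (Finset ι × ι)) (Jf : Finset ι × ι → ι) (ef ēf : Finset ι × ι → V)
    (hdata : (∀ u ∈ U, u.2 ∈ u.1 ∧ u.2 ∉ F ∧ (P u.2 ≠ r ∧ P' u.2 ≠ r) ∧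
      (∀ Y ∈ u.1, P Y = P u.2 ∨ P Y = P' u.2 ∨ P' Y = P u.2 ∨ P' Y = P' u.2) ∧
      ¬ ((∀ I ∈ F, I ∉ u.1) ∨ ∃ a ∈ F, P a = r ∧ a ∈ u.1 ∧ ∀ b ∈ F, b < a → b ∉ u.1) ∧
      Jf u ∈ u.1 ∧ Jf u ∈ F ∧ (∀ I ∈ u.1, I ∈ F → Jf u ≤ I) ∧ P (Jf u) ≠ r ∧
      ((P u.2 = ef u ∧ P' u.2 = ēf u) ∨ (P u.2 = ēf u ∧ P' u.2 = ef u)) ∧ (P (Jf u) = ef u ∨ P' (Jf u) = ef u) ∧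
      ¬ (P (Jf u) = ēf u ∨ P' (Jf u) = ēf u) ∧
      ((P (Jf u) = ef u ∧ P' (Jf u) = r ∧ P (dom u.2 (ēf u)) ≠ r ∧ P' (dom u.2 (ēf u)) ≠ r) ∨
       (P (Jf u) ≠ r ∧ P' (Jf u) ≠ r ∧
        ((P (dom u.2 (ēf u)) = r ∧ P' (dom u.2 (ēf u)) = ēf u ∧ Jf u < dom u.2 (ēf u)) ∨
         (P (dom u.2 (ēf u)) = ēf u ∧ P' (dom u.2 (ēf u)) = r)))) ∧
      (∀ Y ∈ u.1, Y ≠ u.2 → (P Y ≠ r ∧ P' Y ≠ r) → ∀ p, (P u.2 = p ∨ P' u.2 = p) → (P Y ≠ p ∧ P' Y ≠ p) →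
        (P (dom u.2 p) = r ∨ P' (dom u.2 p) = r))))
    (UG UC UH : Finset (Finset ι × ι))
    (hUG : UG = U.filter (fun u => ¬ (P (Jf u) = ef u ∧ P' (Jf u) = r) ∧ ¬ (¬ (P (Jf u) = ef u ∧ P' (Jf u) = r) ∧ dom u.2 (ef u) ≠ Jf u ∧ (P (dom
        u.2 (ef u)) ≠ r ∧ P' (dom u.2 (ef u)) ≠ r)) ∧ ¬ (((u.1.erase u.2).erase (Jf u)).filter (fun K => (P K ≠ r ∧ P' K ≠ r) ∧ K
        ≠ dom u.2 (ēf u))).Nonempty ∧ ¬ (P' (dom u.2 (ēf u)) = r ∧ Jf u = dom u.2 (ef u))))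
    (hUC : UC = U.filter (fun u => (P (Jf u) = ef u ∧ P' (Jf u) = r) ∧ ¬ (((u.1.erase u.2).erase (Jf u)).filter (fun K => (P K ≠ r ∧ P' K ≠ r) ∧ K
        ≠ dom u.2 (ēf u))).Nonempty ∧ dom u.2 (ef u) ≠ Jf u))
    (hUH : UH = U.filter (fun u => ¬ (((u.1.erase u.2).erase (Jf u)).filter (fun K => (P K ≠ r ∧ P' K ≠ r) ∧ K ≠ dom u.2 (ēf u))).Nonempty ∧ (((P
        (Jf u) = ef u ∧ P' (Jf u) = r) ∧ dom u.2 (ef u) = Jf u) ∨ (¬ (P (Jf u) = ef u ∧ P' (Jf u) = r) ∧ ¬ (¬ (P (Jf u) = ef u ∧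
        P' (Jf u) = r) ∧ dom u.2 (ef u) ≠ Jf u ∧ (P (dom u.2 (ef u)) ≠ r ∧ P' (dom u.2 (ef u)) ≠ r)) ∧ (P' (dom u.2 (ēf u)) = r ∧
        Jf u = dom u.2 (ef u)))))) :
    ∑ u ∈ UG, ((∏ k ∈ u.1, θ k) * ∏ k ∈ univ \ u.1, (1 - θ k)) + ∑ u ∈ UC, ((∏ k ∈ u.1, θ k) * ∏ k ∈ univ \ u.1, (1 - θ k)) +
        ∑ u ∈ UH, ((∏ k ∈ u.1, θ k) * ∏ k ∈ univ \ u.1, (1 - θ k)) ≤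
      ∏ k ∈ univ \ (univ : Finset ι).filter (fun K => (K ∉ F ∧ (P K = r ∨ P' K = r)) ∨ (K ∈ F ∧ P K = r)), (1 - θ k) +
      ∑ T ∈ (UG.image (fun u => ({u.2, Jf u, dom u.2 (ēf u)} : Finset ι))), (∑ δ ∈ (univ : Finset (ι → Bool)).filter (fun δ => (∀ K ∉ T, δ K = false) ∧
            3 ≤ (T.image fun K => if δ K then P K else P' K).card ∧ r ∉ T.image fun K => if δ K then P K else P' K),
          ∏ K ∈ T, O K (if δ K then P K else P' K)) +
      ∑ T ∈ ((UG.filter (fun u => (((P u.2 = P I₀ ∨ P' u.2 = P I₀) ∧ I₀ ∈ F ∧ P' I₀ = r) ∧ dom u.2 (ēf u) ≠ I₀))).image (fun u => ({u.2, Jf u, I₀} : Finset ι))),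
        (∑ δ ∈ (univ : Finset (ι → Bool)).filter (fun δ => (∀ K ∉ T, δ K = false) ∧
            3 ≤ (T.image fun K => if δ K then P K else P' K).card ∧ r ∉ T.image fun K => if δ K then P K else P' K),
          ∏ K ∈ T, O K (if δ K then P K else P' K)) +
      ∑ T ∈ (((UG ×ˢ UG).filter (fun w => Jf w.1 = Jf w.2 ∧ w.1.2 < w.2.2 ∧ ēf w.1 ≠ ēf w.2)).image
          (fun w => ({w.1.2, w.2.2, Jf w.1} : Finset ι))),
        (∑ δ ∈ ((univ : Finset (ι → Bool)).filter (fun δ => (∀ K ∉ T, δ K = false) ∧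
            3 ≤ (T.image fun K => if δ K then P K else P' K).card ∧ r ∉ T.image fun K => if δ K then P K else P' K)).filter
            (fun δ => ¬ ∀ K ∈ T, K ∉ F → ∀ I ∈ T, I ∈ F →
              (if δ K then P K else P' K) ≠ P I ∧ (if δ K then P K else P' K) ≠ P' I),
          ∏ K ∈ T, O K (if δ K then P K else P' K)) +
      ∑ T ∈ ((UC ∪ UH).image (fun u => ({u.2, I₀, dom u.2 (if P u.2 = P I₀ then P' u.2 else P u.2)} : Finset ι))),
        (∑ δ ∈ (univ : Finset (ι → Bool)).filter (fun δ => (∀ K ∉ T, δ K = false) ∧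
            3 ≤ (T.image fun K => if δ K then P K else P' K).card ∧ r ∉ T.image fun K => if δ K then P K else P' K),
          ∏ K ∈ T, O K (if δ K then P K else P' K)) +
      ∑ T ∈ ((((UC ∪ UH).image Prod.snd ×ˢ (UC ∪ UH).image Prod.snd).filter (fun p => p.1 < p.2)).image (fun p => ({p.1, p.2, I₀} : Finset ι))),
        (∑ δ ∈ (univ : Finset (ι → Bool)).filter (fun δ => (∀ K ∉ T, δ K = false) ∧
            3 ≤ (T.image fun K => if δ K then P K else P' K).card ∧ r ∉ T.image fun K => if δ K then P K else P' K),
          ∏ K ∈ T, O K (if δ K then P K else P' K)) := by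
  have hdom3 : ∀ X ∉ F, ∀ d, (P X = d ∨ P' X = d) →
      dom X d ∈ F ∧ (P (dom X d) = d ∨ P' (dom X d) = d) ∧
        (∀ u, (P (dom X d) = u ∨ P' (dom X d) = u) → (P X = u ∨ P' X = u) → u = d) :=
    fun X hX d hd => ⟨(hdom X hX d hd).1, (hdom X hX d hd).2.1, (hdom X hX d hd).2.2.1⟩
  -- the two ports of a hub
  have heX : ∀ u ∈ U, P u.2 = ef u ∨ P' u.2 = ef u := by
    intro u hu; obtain ⟨-, -, -, -, -, -, -, -, -, hX, -⟩ := hdata u hu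
    rcases hX with ⟨h, _⟩ | ⟨_, h⟩; exacts [Or.inl h, Or.inr h]
  have hēX : ∀ u ∈ U, P u.2 = ēf u ∨ P' u.2 = ēf u := by
    intro u hu; obtain ⟨-, -, -, -, -, -, -, -, -, hX, -⟩ := hdata u hu
    rcases hX with ⟨_, h⟩ | ⟨h, _⟩; exacts [Or.inr h, Or.inl h]
  have heē : ∀ u ∈ U, ef u ≠ ēf u := by
    intro u hu; obtain ⟨-, -, -, -, -, -, -, -, -, hX, -⟩ := hdata u hu
    rcases hX with ⟨h1, h2⟩ | ⟨h1, h2⟩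
    · rw [← h1, ← h2]; exact hPP' u.2
    · rw [← h1, ← h2]; exact (hPP' u.2).symm
  -- a class through both ports of the hub is the hub; so every other class misses a port of the hub
  have hboth : ∀ u ∈ U, ∀ K, (P K = ef u ∨ P' K = ef u) → (P K = ēf u ∨ P' K = ēf u) → K = u.2 := by
    intro u hu K hKe hKē
    obtain ⟨-, -, -, -, -, -, -, -, -, hX, -⟩ := hdata u hu
    have hne := heē u hu
    apply hinj; simp only
    have hK : (s(P K, P' K) : Sym2 V) = s(ef u, ēf u) := by
      rcases hKe with h1 | h1 <;> rcases hKē with h2 | h2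
      · exact absurd (h1.symm.trans h2) hne
      · rw [h1, h2]
      · rw [h1, h2]; exact Sym2.eq_swap
      · exact absurd (h1.symm.trans h2) hne
    have hXe : (s(P u.2, P' u.2) : Sym2 V) = s(ef u, ēf u) := by
      rcases hX with ⟨h1, h2⟩ | ⟨h1, h2⟩
      · rw [h1, h2]
      · rw [h1, h2]; exact Sym2.eq_swap
    rw [hK, hXe]
  have hmiss : ∀ u ∈ U, ∀ K, K ≠ u.2 → (P K ≠ ef u ∧ P' K ≠ ef u) ∨ (P K ≠ ēf u ∧ P' K ≠ ēf u) := by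
    intro u hu K hKX
    by_cases h1 : P K = ef u ∨ P' K = ef u
    · by_cases h2 : P K = ēf u ∨ P' K = ēf u
      · exact absurd (hboth u hu K h1 h2) hKX
      · exact Or.inr (not_or.1 h2)
    · exact Or.inl (not_or.1 h1)
  -- off R1, `J` avoids `r` and `dom X ē` passes through `r`
  have hJr : ∀ u ∈ U, ¬ (P (Jf u) = ef u ∧ P' (Jf u) = r) →
      (P (Jf u) ≠ r ∧ P' (Jf u) ≠ r) ∧ (P (dom u.2 (ēf u)) = r ∨ P' (dom u.2 (ēf u)) = r) := by
    intro u hu hn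
    obtain ⟨-, -, -, -, -, -, -, -, -, -, -, -, htri, -⟩ := hdata u hu
    rcases htri with ⟨h1, h2, -⟩ | ⟨h1, h2, hD⟩
    · exact absurd ⟨h1, h2⟩ hn
    · refine ⟨⟨h1, h2⟩, ?_⟩
      rcases hD with ⟨h, -, -⟩ | ⟨-, h⟩; exacts [Or.inl h, Or.inr h]
  -- on R1, `J = I₀` is the leaf class, `e = q₀`, the far port is the non-`q₀` port and `dom X ē` is cold
  have hR1 : ∀ u ∈ U, (P (Jf u) = ef u ∧ P' (Jf u) = r) →
      Jf u = I₀ ∧ P I₀ = ef u ∧ I₀ ∈ F ∧ P' I₀ = r ∧ I₀ ∈ u.1 ∧ (P u.2 = P I₀ ∨ P' u.2 = P I₀) ∧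
      (if P u.2 = P I₀ then P' u.2 else P u.2) = ēf u ∧ (P (dom u.2 (ēf u)) ≠ r ∧ P' (dom u.2 (ēf u)) ≠ r) := by
    intro u hu h1
    obtain ⟨-, -, -, -, -, hJS, hJF, -, -, hX, -, -, htri, -⟩ := hdata u hu
    have hJI : Jf u = I₀ := hleaf _ hJF h1.2
    have heq : P I₀ = ef u := by rw [← hJI]; exact h1.1
    have hcold : P (dom u.2 (ēf u)) ≠ r ∧ P' (dom u.2 (ēf u)) ≠ r := by
      rcases htri with ⟨-, -, hc1, hc2⟩ | ⟨-, h2, -⟩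
      · exact ⟨hc1, hc2⟩
      · exact absurd h1.2 h2
    have hIF : I₀ ∈ F := by rw [← hJI]; exact hJF
    have hIr : P' I₀ = r := by rw [← hJI]; exact h1.2
    have hIS : I₀ ∈ u.1 := by rw [← hJI]; exact hJS
    refine ⟨hJI, heq, hIF, hIr, hIS, by rw [heq]; exact heX u hu, ?_, hcold⟩
    rw [heq]
    rcases hX with ⟨hx1, hx2⟩ | ⟨hx1, hx2⟩
    · rw [if_pos hx1, hx2]
    · rw [if_neg (by rw [hx1]; exact (heē u hu).symm), hx1]
  -- a dominator through `q₀ = P I₀` that passes through `r` is the leaf class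
  have hdomI : ∀ X ∉ F, ∀ d, (P X = d ∨ P' X = d) → d = P I₀ → I₀ ∈ F → P' I₀ = r →
      (P (dom X d) = r ∨ P' (dom X d) = r) → dom X d = I₀ := by
    intro X hXF d hXd hdq hIF hIr hr
    obtain ⟨hDF, hDd, -, -⟩ := hdom X hXF d hXd
    rcases hr with h | h
    · apply hinj; simp only
      have hd' : P' (dom X d) = d := by
        rcases hDd with h' | h'
        · exact absurd (h'.symm.trans h) (by rw [hdq]; exact fun e => hPP' I₀ (e.trans hIr.symm))
        · exact h'
      rw [h, hd', hdq, hIr]; exact Sym2.eq_swap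
    · exact hleaf _ hDF h
  -- the hypotheses of the pool instantiation: group units
  have hUg : ∀ u ∈ UG, u.2 ∈ u.1 ∧ u.2 ∉ F ∧ (P u.2 ≠ r ∧ P' u.2 ≠ r) ∧ Jf u ∈ u.1 ∧ Jf u ∈ F ∧
      (P (Jf u) ≠ r ∧ P' (Jf u) ≠ r) ∧ Jf u ≠ I₀ ∧
      ((P u.2 = ef u ∧ P' u.2 = ēf u) ∨ (P u.2 = ēf u ∧ P' u.2 = ef u)) ∧ (P (Jf u) = ef u ∨ P' (Jf u) = ef u) ∧
      ¬ (P (Jf u) = ēf u ∨ P' (Jf u) = ēf u) ∧ (P (dom u.2 (ēf u)) = r ∨ P' (dom u.2 (ēf u)) = r) ∧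
      ¬ (P' (dom u.2 (ēf u)) = r ∧ Jf u = dom u.2 (ef u)) ∧
      (∀ K ∈ u.1, K ≠ u.2 → K ≠ Jf u → (P K = r ∨ P' K = r)) ∧
      (∀ Y ∈ u.1, P Y = P u.2 ∨ P Y = P' u.2 ∨ P' Y = P u.2 ∨ P' Y = P' u.2) := by
    intro u hu
    rw [hUG, mem_filter] at hu
    obtain ⟨huU, hn1, -, hnR, hnb⟩ := hu
    obtain ⟨hXS, hXF, hXr, hadj, -, hJS, hJF, -, -, hX, hJe, hJē, -, -⟩ := hdata u huU
    obtain ⟨hJr', hhot⟩ := hJr u huU hn1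
    have hJI : Jf u ≠ I₀ := by
      intro h
      have hIF : I₀ ∈ F := by rw [← h]; exact hJF
      exact hJr'.2 (by rw [h]; exact hI₀r hIF)
    refine ⟨hXS, hXF, hXr, hJS, hJF, hJr', hJI, hX, hJe, hJē, hhot, hnb, fun K hK hKX hKJ => ?_, hadj⟩
    by_contra hKr
    obtain ⟨hK1, hK2⟩ := not_or.1 hKr
    refine hnR ⟨K, mem_filter.2 ⟨mem_erase.2 ⟨hKJ, mem_erase.2 ⟨hKX, hK⟩⟩, ⟨hK1, hK2⟩, fun hKD => ?_⟩⟩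
    rw [hKD] at hK1 hK2
    rcases hhot with h | h; exacts [hK1 h, hK2 h]
  -- cold `I₀`-units
  have hUc : ∀ u ∈ UC, u.2 ∈ u.1 ∧ u.2 ∉ F ∧ (P u.2 ≠ r ∧ P' u.2 ≠ r) ∧ (P u.2 = P I₀ ∨ P' u.2 = P I₀) ∧ I₀ ∈ u.1 ∧
      I₀ ∈ F ∧ P' I₀ = r ∧ dom u.2 (P I₀) ≠ I₀ ∧
      (P (dom u.2 (if P u.2 = P I₀ then P' u.2 else P u.2)) ≠ r ∧ P' (dom u.2 (if P u.2 = P I₀ then P' u.2 else P u.2)) ≠ r) ∧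
      (∀ K ∈ u.1, K ≠ u.2 → K ≠ I₀ → (P K = r ∨ P' K = r)) := by
    intro u hu
    rw [hUC, mem_filter] at hu
    obtain ⟨huU, h1, -, hDJ⟩ := hu
    obtain ⟨hXS, hXF, hXr, -, -, -, -, -, -, -, -, -, -, hNR⟩ := hdata u huU
    obtain ⟨hJI, heq, hIF, hIr, hIS, hXq, ha, hcold⟩ := hR1 u huU h1
    have hDJ' : dom u.2 (P I₀) ≠ I₀ := by rw [heq, ← hJI]; exact hDJ
    refine ⟨hXS, hXF, hXr, hXq, hIS, hIF, hIr, hDJ', by rw [ha]; exact hcold, fun K hK hKX hKI => ?_⟩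
    by_contra hKr
    obtain ⟨hK1, hK2⟩ := not_or.1 hKr
    rcases hmiss u huU K hKX with hm | hm
    · -- `K` misses `e = q₀`: then `dom X q₀ ∋ r`, i.e. `dom X q₀ = I₀`
      have h := hNR K hK hKX ⟨hK1, hK2⟩ (ef u) (heX u huU) hm
      exact hDJ' (hdomI u.2 hXF (P I₀) hXq rfl hIF hIr (by rw [heq]; exact h))
    · have h := hNR K hK hKX ⟨hK1, hK2⟩ (ēf u) (hēX u huU) hm
      rcases h with h | h; exacts [hcold.1 h, hcold.2 h]
  -- bundle units
  have hUh : ∀ u ∈ UH, u.2 ∈ u.1 ∧ u.2 ∉ F ∧ (P u.2 ≠ r ∧ P' u.2 ≠ r) ∧ (P u.2 = P I₀ ∨ P' u.2 = P I₀) ∧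
      I₀ ∈ F ∧ P' I₀ = r ∧ dom u.2 (P I₀) = I₀ ∧
      (P (dom u.2 (if P u.2 = P I₀ then P' u.2 else P u.2)) ≠ r ∧ P' (dom u.2 (if P u.2 = P I₀ then P' u.2 else P u.2)) ≠ r) ∧
      (I₀ ∈ u.1 ∨ dom u.2 (if P u.2 = P I₀ then P' u.2 else P u.2) ∈ u.1) ∧
      (∀ K ∈ u.1, K ≠ u.2 → K ≠ I₀ → K ≠ dom u.2 (if P u.2 = P I₀ then P' u.2 else P u.2) → (P K = r ∨ P' K = r)) := by
    intro u hu
    rw [hUH, mem_filter] at hu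
    obtain ⟨huU, hnR, hcase⟩ := hu
    obtain ⟨hXS, hXF, hXr, -, -, hJS, hJF, -, -, hX, -, -, -, -⟩ := hdata u huU
    -- riders avoiding `r` other than `J` and `dom X ē` do not exist
    have hrid : ∀ K ∈ u.1, K ≠ u.2 → K ≠ Jf u → K ≠ dom u.2 (ēf u) → (P K = r ∨ P' K = r) := by
      intro K hK hKX hKJ hKD
      by_contra hKr
      obtain ⟨hK1, hK2⟩ := not_or.1 hKr
      exact hnR ⟨K, mem_filter.2 ⟨mem_erase.2 ⟨hKJ, mem_erase.2 ⟨hKX, hK⟩⟩, ⟨hK1, hK2⟩, hKD⟩⟩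
    rcases hcase with ⟨h1, hDJ⟩ | ⟨hn1, -, hb1, hb2⟩
    · obtain ⟨hJI, heq, hIF, hIr, hIS, hXq, ha, hcold⟩ := hR1 u huU h1
      have hDI : dom u.2 (P I₀) = I₀ := by rw [heq, hDJ, hJI]
      refine ⟨hXS, hXF, hXr, hXq, hIF, hIr, hDI, by rw [ha]; exact hcold, Or.inl hIS, fun K hK hKX hKI hKD => ?_⟩
      rw [ha] at hKD
      exact hrid K hK hKX (by rw [hJI]; exact hKI) hKD
    · obtain ⟨hJr', -⟩ := hJr u huU hn1
      obtain ⟨hDF, hDē, -, -⟩ := hdom u.2 hXF (ēf u) (hēX u huU)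
      have hDI : dom u.2 (ēf u) = I₀ := hleaf _ hDF hb1
      have hIr : P' I₀ = r := by rw [← hDI]; exact hb1
      have hIF : I₀ ∈ F := by rw [← hDI]; exact hDF
      have heq : P I₀ = ēf u := by
        rw [← hDI]
        rcases hDē with h | h
        · exact h
        · have hēr : ēf u = r := h.symm.trans hb1
          rcases hēX u huU with h' | h'
          · exact absurd (h'.trans hēr) hXr.1
          · exact absurd (h'.trans hēr) hXr.2
      have hXq : P u.2 = P I₀ ∨ P' u.2 = P I₀ := by rw [heq]; exact hēX u huU
      have ha : (if P u.2 = P I₀ then P' u.2 else P u.2) = ef u := by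
        rw [heq]
        rcases hX with ⟨hx1, hx2⟩ | ⟨hx1, hx2⟩
        · rw [if_neg (by rw [hx1]; exact heē u huU), hx1]
        · rw [if_pos hx1, hx2]
      have hDI' : dom u.2 (P I₀) = I₀ := by rw [heq]; exact hDI
      refine ⟨hXS, hXF, hXr, hXq, hIF, hIr, hDI', by rw [ha, ← hb2]; exact hJr', Or.inr (by rw [ha, ← hb2]; exact hJS),
        fun K hK hKX hKI hKD => ?_⟩
      rw [ha, ← hb2] at hKD
      exact hrid K hK hKX hKD (by rw [hDI]; exact hKI)
  -- the pool, instantiated, and the word bounds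
  have key := residual_pool_inst P P' hPP' hinj r F θ hθ0 hθ1 O hO1 dom hdom I₀ hI₀pool hleaf UG UC UH Jf ef ēf hUg hUc hUh
  rw [← image_union] at key
  have h1 := pool_words_self_le P P' hPP' hinj r F O hO0 dom hdom3 I₀ UG Jf ef ēf hUg
  have h2 := pool_words_cross_le P P' hPP' r F O hO0 dom I₀ UG Jf ef ēf hUg
  have hUI : ∀ u ∈ UC ∪ UH, u.2 ∉ F ∧ (P u.2 ≠ r ∧ P' u.2 ≠ r) ∧ (P u.2 = P I₀ ∨ P' u.2 = P I₀) ∧ I₀ ∈ F ∧ P' I₀ = r ∧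
      (P (dom u.2 (if P u.2 = P I₀ then P' u.2 else P u.2)) ≠ r ∧ P' (dom u.2 (if P u.2 = P I₀ then P' u.2 else P u.2)) ≠ r) := by
    intro u hu
    rcases mem_union.1 hu with hu | hu
    · obtain ⟨-, hXF, hXr, hXq, -, hIF, hIr, -, hD, -⟩ := hUc u hu
      exact ⟨hXF, hXr, hXq, hIF, hIr, hD⟩
    · obtain ⟨-, hXF, hXr, hXq, hIF, hIr, -, hD, -⟩ := hUh u hu
      exact ⟨hXF, hXr, hXq, hIF, hIr, hD⟩
  have h3 := pool_words_selfI_le P P' hPP' r F O hO0 dom hdom3 I₀ (UC ∪ UH) hUI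
  have h4 := pool_words_crossI_le P P' hPP' hinj r F O hO0 dom hdom3 I₀ (UC ∪ UH) hUI
  -- the CROSS index set in the `ēf` form
  have hsel : ∀ u ∈ UG, (if (P u.2 = P (Jf u) ∨ P u.2 = P' (Jf u)) then P' u.2 else P u.2) = ēf u := by
    intro u hu
    obtain ⟨-, -, -, -, -, -, -, hX, hJe, hJē, -⟩ := hUg u hu
    rcases hX with ⟨hx1, hx2⟩ | ⟨hx1, hx2⟩
    · have hc : P u.2 = P (Jf u) ∨ P u.2 = P' (Jf u) := by
        rw [hx1]; rcases hJe with h | h; exacts [Or.inl h.symm, Or.inr h.symm]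
      rw [if_pos hc, hx2]
    · have hc : ¬ (P u.2 = P (Jf u) ∨ P u.2 = P' (Jf u)) := by
        rw [hx1]; rintro (h | h); exacts [hJē (Or.inl h.symm), hJē (Or.inr h.symm)]
      rw [if_neg hc, hx1]
  have hfilt : (UG ×ˢ UG).filter (fun w => Jf w.1 = Jf w.2 ∧ w.1.2 < w.2.2 ∧
          ¬ (w.1.2 ≠ w.2.2 ∧ (if (P w.1.2 = P (Jf w.1) ∨ P w.1.2 = P' (Jf w.1)) then P' w.1.2
                else P w.1.2) = (if (P w.2.2 = P (Jf w.1) ∨ P w.2.2 = P' (Jf w.1)) then P' w.2.2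
                else P w.2.2))) =
      (UG ×ˢ UG).filter (fun w => Jf w.1 = Jf w.2 ∧ w.1.2 < w.2.2 ∧ ēf w.1 ≠ ēf w.2) := by
    refine filter_congr fun w hw => ?_
    obtain ⟨hw1, hw2⟩ := mem_product.1 hw
    constructor
    · rintro ⟨hJ, hlt, hne⟩
      refine ⟨hJ, hlt, fun he => hne ⟨ne_of_lt hlt, ?_⟩⟩
      rw [hsel w.1 hw1, hJ, hsel w.2 hw2]; exact he
    · rintro ⟨hJ, hlt, hne⟩
      refine ⟨hJ, hlt, fun h => hne ?_⟩
      have h2 := h.2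
      rw [hsel w.1 hw1, hJ, hsel w.2 hw2] at h2; exact h2
  rw [hfilt] at h2
  linarith [key, h1, h2, h3, h4]

end StarSet

end Summit.CriticalPhenomena.PercolationContinuityZ3.Theorems
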